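import Mathlib
import HarnessLib

/-!
# SpectralPin, analytic lemma: uniqueness of exponential asymptotics
(route `SAWTowerCount`, support item stmt-CriticalPhenomena-7259 `SpectralPin`; helper, `--supports`).

**Lemma U (fiber form).** If a finite real exponential sum is exponentially small,
`|∑_{i∈s} α_i e^{−r_i m}| ≤ C e^{−ρ m}` for all `m ≥ M`, then for every rate value `v < ρ` the total
coefficient carried by that rate vanishes: `∑_{i∈s, r_i = v} α_i = 0`.
(Rates may coincide; the statement is about fibers of `r`, so no distinctness hypothesis is needed.)
Proof: strong induction on `s`; multiply by `e^{v₀ m}` for the minimal rate `v₀` and let `m → ∞`.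

This is the "termwise identification" step of the exponential-fitting argument behind `SpectralPin`:
two exponential expansions of the same function that agree up to `O(e^{−ρm})` have the same
coefficients at every rate below `ρ`. Elementary; no cited facts.
-/

noncomputable section

namespace Summit.CriticalPhenomena.SAWScalingLimit.Theorems.SpectralPin

open Filter Topology

/-- **Uniqueness of exponential asymptotics (fiber form).** If
`|∑_{i∈s} α i · e^{−r i · m}| ≤ C e^{−ρ m}` for all `m ≥ M`, then `∑_{i∈s, r i = v} α i = 0` for every
`v < ρ`. -/
theorem expSum_fiber_eq_zero {ι : Type*} [DecidableEq ι] (s : Finset ι) (r α : ι → ℝ) (ρ C M : ℝ)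
    (h : ∀ m : ℝ, M ≤ m → |∑ i ∈ s, α i * Real.exp (-(r i * m))| ≤ C * Real.exp (-(ρ * m)))
    (v : ℝ) (hv : v < ρ) : ∑ i ∈ s.filter (fun i => r i = v), α i = 0 := by
  induction s using Finset.strongInduction generalizing v with
  | H s ih =>
    rcases s.eq_empty_or_nonempty with hs | hs
    · simp [hs]
    -- minimal rate present in `s`
    have hne : (s.image r).Nonempty := hs.image r
    set v₀ : ℝ := (s.image r).min' hne with hv₀
    have hmin : ∀ i ∈ s, v₀ ≤ r i := fun i hi =>
      Finset.min'_le _ _ (Finset.mem_image_of_mem r hi)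
    obtain ⟨i₀, hi₀s, hi₀⟩ : ∃ i₀ ∈ s, r i₀ = v₀ := by
      have := Finset.min'_mem _ hne
      rw [← hv₀, Finset.mem_image] at this
      exact this
    by_cases hvv : v < v₀
    · -- empty fiber
      have : s.filter (fun i => r i = v) = ∅ := by
        apply Finset.filter_eq_empty_iff.mpr
        intro i hi hri
        exact absurd (hri ▸ hmin i hi) (not_le.mpr hvv)
      simp [this]
    push Not at hvv
    -- `v₀ ≤ v < ρ`; first the minimal fiber vanishes
    have hv₀ρ : v₀ < ρ := lt_of_le_of_lt hvv hv
    set S₀ : ℝ := ∑ i ∈ s.filter (fun i => r i = v₀), α i with hS₀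
    set T : ℝ → ℝ := fun m => ∑ i ∈ s.filter (fun i => ¬ r i = v₀),
      α i * Real.exp (-((r i - v₀) * m)) with hT
    have hsplit : ∀ m : ℝ, (∑ i ∈ s, α i * Real.exp (-(r i * m))) * Real.exp (v₀ * m) = S₀ + T m := by
      intro m
      rw [Finset.sum_mul, ← Finset.sum_filter_add_sum_filter_not s (fun i => r i = v₀)]
      congr 1
      · rw [hS₀]
        refine Finset.sum_congr rfl fun i hi => ?_
        rw [Finset.mem_filter] at hi
        rw [hi.2, mul_assoc, ← Real.exp_add, neg_add_cancel, Real.exp_zero, mul_one]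
      · refine Finset.sum_congr rfl fun i _ => ?_
        rw [mul_assoc, ← Real.exp_add]
        congr 1; congr 1; ring
    have hT0 : Tendsto T atTop (𝓝 0) := by
      have : (0 : ℝ) = ∑ i ∈ s.filter (fun i => ¬ r i = v₀), α i * 0 := by simp
      rw [this]
      refine tendsto_finsetSum _ fun i hi => ?_
      rw [Finset.mem_filter] at hi
      have hpos : 0 < r i - v₀ := sub_pos.mpr (lt_of_le_of_ne (hmin i hi.1) (Ne.symm hi.2))
      have hk : Tendsto (fun m : ℝ => Real.exp (-((r i - v₀) * m))) atTop (𝓝 0) :=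
        Real.tendsto_exp_atBot.comp (tendsto_neg_atTop_atBot.comp (tendsto_id.const_mul_atTop hpos))
      exact hk.const_mul (α i)
    have hST0 : Tendsto (fun m => S₀ + T m) atTop (𝓝 0) := by
      have hC : Tendsto (fun m : ℝ => C * Real.exp (-((ρ - v₀) * m))) atTop (𝓝 0) := by
        have hk : Tendsto (fun m : ℝ => Real.exp (-((ρ - v₀) * m))) atTop (𝓝 0) :=
          Real.tendsto_exp_atBot.comp (tendsto_neg_atTop_atBot.comp
            (tendsto_id.const_mul_atTop (sub_pos.mpr hv₀ρ)))
        simpa using hk.const_mul C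
      refine squeeze_zero_norm' ?_ hC
      filter_upwards [eventually_ge_atTop M] with m hm
      rw [Real.norm_eq_abs, ← hsplit m, abs_mul, Real.abs_exp]
      calc |∑ i ∈ s, α i * Real.exp (-(r i * m))| * Real.exp (v₀ * m)
          ≤ C * Real.exp (-(ρ * m)) * Real.exp (v₀ * m) :=
            mul_le_mul_of_nonneg_right (h m hm) (Real.exp_pos _).le
        _ = C * Real.exp (-((ρ - v₀) * m)) := by
            rw [mul_assoc, ← Real.exp_add]; congr 1; congr 1; ring
    have hS₀0 : S₀ = 0 := by
      have h1 : Tendsto (fun m => (S₀ + T m) - T m) atTop (𝓝 (0 - 0)) := hST0.sub hT0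
      simp only [add_sub_cancel_right, sub_zero] at h1
      exact tendsto_nhds_unique tendsto_const_nhds h1
    -- the smaller set without the minimal fiber satisfies the same hypothesis
    set s' := s.filter (fun i => ¬ r i = v₀) with hs'
    have hsub : s' ⊂ s := by
      refine Finset.filter_ssubset.mpr ⟨i₀, hi₀s, ?_⟩
      simp [hi₀]
    have h' : ∀ m : ℝ, M ≤ m →
        |∑ i ∈ s', α i * Real.exp (-(r i * m))| ≤ C * Real.exp (-(ρ * m)) := by
      intro m hm
      have hzero : ∑ i ∈ s.filter (fun i => r i = v₀), α i * Real.exp (-(r i * m)) = 0 := by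
        have : ∑ i ∈ s.filter (fun i => r i = v₀), α i * Real.exp (-(r i * m))
            = (∑ i ∈ s.filter (fun i => r i = v₀), α i) * Real.exp (-(v₀ * m)) := by
          rw [Finset.sum_mul]
          refine Finset.sum_congr rfl fun i hi => ?_
          rw [Finset.mem_filter] at hi
          rw [hi.2]
        rw [this, ← hS₀, hS₀0, zero_mul]
      have : ∑ i ∈ s', α i * Real.exp (-(r i * m)) = ∑ i ∈ s, α i * Real.exp (-(r i * m)) := by
        rw [← Finset.sum_filter_add_sum_filter_not s (fun i => r i = v₀), hzero, zero_add]
      rw [this]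
      exact h m hm
    have ih' := ih s' hsub h' v hv
    rcases eq_or_lt_of_le hvv with heq | hlt
    · -- `v = v₀`: the minimal fiber itself
      rw [← heq, ← hS₀]; exact hS₀0
    · -- `v > v₀`: the fiber lies inside `s'`
      have : s.filter (fun i => r i = v) = s'.filter (fun i => r i = v) := by
        rw [hs', Finset.filter_filter]
        refine Finset.filter_congr fun i _ => ?_
        constructor
        · intro hri
          refine ⟨fun h0 => ?_, hri⟩
          rw [h0] at hri; rw [hri] at hlt; exact (lt_irrefl _ hlt).elim
        · exact fun h => h.2
      rw [this]; exact ih'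

end Summit.CriticalPhenomena.SAWScalingLimit.Theorems.SpectralPin
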